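import Summits.NavierStokesRegularity.FluidComputer.LipschitzRowInterpolation
import HarnessLib

/-!
# Fluid computer — support: the `Ḃ^{5/2}_{2,1}` row between TWO ROWS STRADDLING `5/2`,
# `(∑_l 2^{5l/2} ‖Δ̇_l v‖₂)⁴ ≤ C_δ · (∑_j 2^{(5−δ)j} ‖Δ̇_j v‖₂²) · (∑_j 2^{(5+δ)j} ‖Δ̇_j v‖₂²)`

HONEST FRAMING (cell `pub-fluidc`, verbatim): *low prior, high value-of-information experiment on Tao's
machine paradigm; NOT a claim that NS blows up.* Support file (pure bookkeeping; no blow-up content).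
`LipschitzRowInterpolation` interpolated the `Ḃ^{5/2}_{2,1}` row between the ENERGY and one high row (`κ > 5`); here it is
interpolated between the two `Ḃ^{κ/2}_{2,2}` rows `κ₋ = 5 − δ`, `κ₊ = 5 + δ` (`δ > 0`) — the standard
`Ḃ^{5/2}_{2,1} ⊃ (Ḃ^{5/2−δ/2}_{2,2}, Ḃ^{5/2+δ/2}_{2,2})_{1/2,1}`, Robinson–Sadowski–Silva's `‖u‖_{F¹} ≤ c ‖u‖_{5/2−}^{1/2} ‖u‖_{5/2+}^{1/2}`
(their §V.A) in dyadic currency, with NO energy and NO viscosity: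

* `tsum_low_le_sqrt_52` — Cauchy–Schwarz BELOW a level: `∑_{n≥0} 2^{5(J−1−n)/2} a_{J−1−n} ≤
  (2^{(5−2σ)(J−1)} G_σ⁻)^{1/2} (∑_n 2^{2σ(J−1−n)} a_{J−1−n}²)^{1/2}`, `G_σ⁻ = ∑_n (2^{−(5−2σ)})^n < ∞` for `σ < 5/2`
  (`LipschitzRowInterpolation.tsum_tail_le_sqrt_52` is the sum ABOVE a level, finite factor for `σ > 5/2`);
* `lipRow_le_straddle` — at every level `J`: `∑_l 2^{5l/2} a_l ≤ (2^{δ(J−1)} G₋)^{1/2} Y₋^{1/2} + (2^{−δJ} G₊)^{1/2} Y₊^{1/2}`;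
* `lipRow_ne_top_of_straddle`, `lipRow_pow_four_le` — for `v ∈ L²` with finite `Y_{5−δ}`, `Y_{5+δ}`: the row is finite and
  `(∑_l 2^{5l/2} a_l)⁴ ≤ C_δ · Y_{5−δ} · Y_{5+δ}` (real numbers; `dyadic_optimisation_p` with `p = θ = δ/2`).

0 sorry; no definitions; no named facts.

## References

* J. C. Robinson, W. Sadowski, R. P. Silva, J. Math. Phys. 53 (2012) 115618, §III (3.10), §V.A. [RobinsonSadowskiSilva2012]
* H. Bahouri, J.-Y. Chemin, R. Danchin, Grundlehren 343 (2011), Prop. 2.22. [BahouriCheminDanchin2011]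
-/

noncomputable section

open MeasureTheory Set Function Filter Topology
open scoped ENNReal NNReal
open Literature.Analysis.FluidPDE Literature.Analysis.FunctionSpaces
open Summit.NavierStokesRegularity.FluidComputer.SobolevLadderFront (tsum_geom_lt_top)
open Summit.NavierStokesRegularity.FluidComputer.CriticalLevels (tsum_int_eq_low_add_tail)
open Summit.NavierStokesRegularity.FluidComputer.LipschitzRowInterpolation

namespace Summit.NavierStokesRegularity.FluidComputer.StraddleInterpolation

/-! ## Cauchy–Schwarz below a level at the exponent `5/2` -/

/-- **Cauchy–Schwarz over the levels BELOW `J` at `5/2`**: for any `σ`, any `a : ℤ → [0, ∞]` and `J ∈ ℤ`,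
`∑_{n≥0} 2^{5(J−1−n)/2} a_{J−1−n} ≤ (2^{(5−2σ)(J−1)} G)^{1/2} (∑_{n≥0} 2^{2σ(J−1−n)} a_{J−1−n}²)^{1/2}`, `G = ∑_n (2^{−(5−2σ)})^n`
(finite for `σ < 5/2`). [folklore] -/
theorem tsum_low_le_sqrt_52 (a : ℤ → ℝ≥0∞) (J : ℤ) (σ : ℝ) :
    ∑' n : ℕ, (2 : ℝ≥0∞) ^ ((5 / 2 : ℝ) * ((J - 1 - n : ℤ) : ℝ)) * a (J - 1 - n) ≤
      ((2 : ℝ≥0∞) ^ ((5 - 2 * σ) * ((J - 1 : ℤ) : ℝ)) * ∑' n : ℕ, ((2 : ℝ≥0∞) ^ (-(5 - 2 * σ))) ^ n) ^ (1 / 2 : ℝ) *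
        (∑' n : ℕ, (2 : ℝ≥0∞) ^ ((2 * σ) * ((J - 1 - n : ℤ) : ℝ)) * a (J - 1 - n) ^ 2) ^ (1 / 2 : ℝ) := by
  set f : ℕ → ℝ≥0∞ := fun n => (2 : ℝ≥0∞) ^ ((5 / 2 - σ) * ((J - 1 - n : ℤ) : ℝ)) with hf
  set g : ℕ → ℝ≥0∞ := fun n => (2 : ℝ≥0∞) ^ (σ * ((J - 1 - n : ℤ) : ℝ)) * a (J - 1 - n) with hg
  have h2 : (2 : ℝ≥0∞) ≠ 0 := two_ne_zero
  have h2' : (2 : ℝ≥0∞) ≠ ⊤ := ENNReal.ofNat_ne_top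
  have hfg : ∀ n, f n * g n = (2 : ℝ≥0∞) ^ ((5 / 2 : ℝ) * ((J - 1 - n : ℤ) : ℝ)) * a (J - 1 - n) := by
    intro n
    simp only [hf, hg]
    rw [← mul_assoc, ← ENNReal.rpow_add _ _ h2 h2']
    congr 2
    ring
  have hH := ENNReal.lintegral_mul_le_Lp_mul_Lq (Measure.count : Measure ℕ) Real.HolderConjugate.two_two
    (measurable_from_nat (f := f)).aemeasurable (measurable_from_nat (f := g)).aemeasurable
  rw [lintegral_count, lintegral_count, lintegral_count] at hH
  simp only [Pi.mul_apply] at hH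
  have hf2 : ∑' n : ℕ, f n ^ (2 : ℝ) =
      (2 : ℝ≥0∞) ^ ((5 - 2 * σ) * ((J - 1 : ℤ) : ℝ)) * ∑' n : ℕ, ((2 : ℝ≥0∞) ^ (-(5 - 2 * σ))) ^ n := by
    have hterm : ∀ n : ℕ, f n ^ (2 : ℝ) =
        (2 : ℝ≥0∞) ^ ((5 - 2 * σ) * ((J - 1 : ℤ) : ℝ)) * ((2 : ℝ≥0∞) ^ (-(5 - 2 * σ))) ^ n := by
      intro n
      simp only [hf]
      rw [← ENNReal.rpow_mul, ← ENNReal.rpow_natCast, ← ENNReal.rpow_mul, ← ENNReal.rpow_add _ _ h2 h2']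
      congr 1
      push_cast
      ring
    rw [tsum_congr hterm, ENNReal.tsum_mul_left]
  have hg2 : ∑' n : ℕ, g n ^ (2 : ℝ) = ∑' n : ℕ, (2 : ℝ≥0∞) ^ ((2 * σ) * ((J - 1 - n : ℤ) : ℝ)) * a (J - 1 - n) ^ 2 := by
    refine tsum_congr fun n => ?_
    simp only [hg]
    rw [ENNReal.mul_rpow_of_nonneg _ _ (by norm_num : (0 : ℝ) ≤ 2), ← ENNReal.rpow_mul, ENNReal.rpow_two]
    congr 2
    ring
  calc ∑' n : ℕ, (2 : ℝ≥0∞) ^ ((5 / 2 : ℝ) * ((J - 1 - n : ℤ) : ℝ)) * a (J - 1 - n)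
      = ∑' n : ℕ, f n * g n := tsum_congr fun n => (hfg n).symm
    _ ≤ (∑' n : ℕ, f n ^ (2 : ℝ)) ^ (1 / (2 : ℝ)) * (∑' n : ℕ, g n ^ (2 : ℝ)) ^ (1 / (2 : ℝ)) := hH
    _ = _ := by rw [hf2, hg2]

/-! ## The `Ḃ^{5/2}_{2,1}` row between two straddling rows -/

/-- **The `Ḃ^{5/2}_{2,1}` row split at a level, both sides by rows.** For any `a`-free statement: for `v : ℝ³ → ℝ³`,
every `σm, σp` and every `J ∈ ℤ`:
`∑_l 2^{5l/2} ‖Δ̇_l v‖₂ ≤ (2^{(5−2σm)(J−1)} G₋)^{1/2} (∑_j 2^{2σm j} a_j²)^{1/2} + (2^{(5−2σp)J} G₊)^{1/2} (∑_j 2^{2σp j} a_j²)^{1/2}`,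
`G₋ = ∑_n (2^{−(5−2σm)})^n`, `G₊ = ∑_n (2^{5−2σp})^n` (finite for `σm < 5/2 < σp`).
[cite: RobinsonSadowskiSilva2012, §V.A] [cite: BahouriCheminDanchin2011, Prop. 2.22] -/
theorem lipRow_le_straddle (v : EuclideanSpace ℝ (Fin 3) → EuclideanSpace ℝ (Fin 3)) (σm σp : ℝ) (J : ℤ) :
    ∑' l : ℤ, (2 : ℝ≥0∞) ^ ((5 / 2 : ℝ) * (l : ℝ)) * blockL2 v l ≤
      ((2 : ℝ≥0∞) ^ ((5 - 2 * σm) * ((J - 1 : ℤ) : ℝ)) * ∑' n : ℕ, ((2 : ℝ≥0∞) ^ (-(5 - 2 * σm))) ^ n) ^ (1 / 2 : ℝ) *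
          (∑' j : ℤ, (2 : ℝ≥0∞) ^ ((2 * σm) * (j : ℝ)) * blockL2 v j ^ 2) ^ (1 / 2 : ℝ) +
        ((2 : ℝ≥0∞) ^ ((5 - 2 * σp) * (J : ℝ)) * ∑' n : ℕ, ((2 : ℝ≥0∞) ^ (5 - 2 * σp)) ^ n) ^ (1 / 2 : ℝ) *
          (∑' j : ℤ, (2 : ℝ≥0∞) ^ ((2 * σp) * (j : ℝ)) * blockL2 v j ^ 2) ^ (1 / 2 : ℝ) := by
  rw [tsum_int_eq_low_add_tail (fun l => (2 : ℝ≥0∞) ^ ((5 / 2 : ℝ) * (l : ℝ)) * blockL2 v l) J]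
  refine add_le_add ?_ ?_
  · refine (tsum_low_le_sqrt_52 (blockL2 v) J σm).trans (mul_le_mul' le_rfl (ENNReal.rpow_le_rpow ?_ (by norm_num)))
    exact ENNReal.tsum_comp_le_tsum_of_injective (f := fun n : ℕ => J - 1 - (n : ℤ))
      (fun x y hxy => by simpa using hxy) (fun j => (2 : ℝ≥0∞) ^ ((2 * σm) * (j : ℝ)) * blockL2 v j ^ 2)
  · refine (tsum_tail_le_sqrt_52 (blockL2 v) J σp).trans (mul_le_mul' le_rfl (ENNReal.rpow_le_rpow ?_ (by norm_num)))
    exact ENNReal.tsum_comp_le_tsum_of_injective (f := fun n : ℕ => J + (n : ℤ))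
      (fun x y hxy => by simpa using hxy) (fun j => (2 : ℝ≥0∞) ^ ((2 * σp) * (j : ℝ)) * blockL2 v j ^ 2)

/-- **The `Ḃ^{5/2}_{2,1}` row is finite** when two rows straddling `5` are finite. [folklore] -/
theorem lipRow_ne_top_of_straddle (v : EuclideanSpace ℝ (Fin 3) → EuclideanSpace ℝ (Fin 3)) {δ : ℝ} (hδ : 0 < δ)
    (hYm : ∑' j : ℤ, (2 : ℝ≥0∞) ^ ((5 - δ) * (j : ℝ)) * blockL2 v j ^ 2 ≠ ∞)
    (hYp : ∑' j : ℤ, (2 : ℝ≥0∞) ^ ((5 + δ) * (j : ℝ)) * blockL2 v j ^ 2 ≠ ∞) :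
    ∑' l : ℤ, (2 : ℝ≥0∞) ^ ((5 / 2 : ℝ) * (l : ℝ)) * blockL2 v l ≠ ∞ := by
  have h := lipRow_le_straddle v ((5 - δ) / 2) ((5 + δ) / 2) 0
  have e1 : 2 * ((5 - δ) / 2) = 5 - δ := by ring
  have e2 : 2 * ((5 + δ) / 2) = 5 + δ := by ring
  have e3 : (5 : ℝ) - (5 - δ) = δ := by ring
  have e4 : (5 : ℝ) - (5 + δ) = -δ := by ring
  rw [e1, e2, e3, e4] at h
  refine ne_top_of_le_ne_top (ENNReal.add_ne_top.2 ⟨?_, ?_⟩) h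
  · exact ENNReal.mul_ne_top (ENNReal.rpow_ne_top_of_nonneg (by norm_num)
      (ENNReal.mul_ne_top (RiccatiSlice.two_rpow_ne_top _) (tsum_geom_lt_top hδ).ne))
      (ENNReal.rpow_ne_top_of_nonneg (by norm_num) hYm)
  · exact ENNReal.mul_ne_top (ENNReal.rpow_ne_top_of_nonneg (by norm_num)
      (ENNReal.mul_ne_top (RiccatiSlice.two_rpow_ne_top _) (geom_lt_top_of_neg (by linarith : -δ < 0)).ne))
      (ENNReal.rpow_ne_top_of_nonneg (by norm_num) hYp)

/-- **THE `Ḃ^{5/2}_{2,1}` ROW BETWEEN TWO STRADDLING ROWS** (`δ > 0`): there is `C = C_δ > 0` such that for every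
`v : ℝ³ → ℝ³` whose rows `Y₋ = ∑_j 2^{(5−δ)j} ‖Δ̇_j v‖₂²` and `Y₊ = ∑_j 2^{(5+δ)j} ‖Δ̇_j v‖₂²` are finite:
`(∑_l 2^{5l/2} ‖Δ̇_l v‖₂)⁴ ≤ C · Y₋ · Y₊` (real numbers) — `‖u‖_{Ḃ^{5/2}_{2,1}} ≲ ‖u‖_{Ḃ^{5/2−δ/2}_{2,2}}^{1/2} ‖u‖_{Ḃ^{5/2+δ/2}_{2,2}}^{1/2}`,
no energy, no viscosity (`lipRow_le_straddle` at every level, `dyadic_optimisation_p` with `p = θ = δ/2`).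
[cite: RobinsonSadowskiSilva2012, §V.A] [cite: BahouriCheminDanchin2011, Prop. 2.22] -/
theorem lipRow_pow_four_le {δ : ℝ} (hδ : 0 < δ) :
    ∃ C : ℝ, 0 < C ∧ ∀ (v : EuclideanSpace ℝ (Fin 3) → EuclideanSpace ℝ (Fin 3)),
      ∑' j : ℤ, (2 : ℝ≥0∞) ^ ((5 - δ) * (j : ℝ)) * blockL2 v j ^ 2 ≠ ∞ →
      ∑' j : ℤ, (2 : ℝ≥0∞) ^ ((5 + δ) * (j : ℝ)) * blockL2 v j ^ 2 ≠ ∞ →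
      (∑' l : ℤ, (2 : ℝ≥0∞) ^ ((5 / 2 : ℝ) * (l : ℝ)) * blockL2 v l).toReal ^ (4 : ℝ) ≤
        C * (∑' j : ℤ, (2 : ℝ≥0∞) ^ ((5 - δ) * (j : ℝ)) * blockL2 v j ^ 2).toReal *
          (∑' j : ℤ, (2 : ℝ≥0∞) ^ ((5 + δ) * (j : ℝ)) * blockL2 v j ^ 2).toReal := by
  set Gm : ℝ≥0∞ := ∑' n : ℕ, ((2 : ℝ≥0∞) ^ (-δ)) ^ n with hGm
  set Gp : ℝ≥0∞ := ∑' n : ℕ, ((2 : ℝ≥0∞) ^ (-δ)) ^ n with hGp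
  have hGmtop : Gm ≠ ∞ := (tsum_geom_lt_top hδ).ne
  -- real constants: `α₀ = (2^{-δ} Gm)^{1/2}`, `β = Gm^{1/2} + 1`
  set α₀ : ℝ := ((2 : ℝ) ^ (-δ) * Gm.toReal) ^ (1 / 2 : ℝ) with hα₀
  set β : ℝ := Gm.toReal ^ (1 / 2 : ℝ) + 1 with hβ
  have hα₀0 : 0 ≤ α₀ := by positivity
  have hβ0 : 0 < β := by positivity
  set Cbig : ℝ := (2 : ℝ) ^ (2 + 2 * (δ / 2) + 2 * (δ / 2) / (δ / 2)) * α₀ ^ (2 * (δ / 2) / (δ / 2)) * β ^ 2 + 1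
    with hCbig
  refine ⟨Cbig, by positivity, fun v hYm hYp => ?_⟩
  set P : ℝ≥0∞ := ∑' l : ℤ, (2 : ℝ≥0∞) ^ ((5 / 2 : ℝ) * (l : ℝ)) * blockL2 v l with hP
  set Ym : ℝ≥0∞ := ∑' j : ℤ, (2 : ℝ≥0∞) ^ ((5 - δ) * (j : ℝ)) * blockL2 v j ^ 2 with hYm'
  set Yp : ℝ≥0∞ := ∑' j : ℤ, (2 : ℝ≥0∞) ^ ((5 + δ) * (j : ℝ)) * blockL2 v j ^ 2 with hYp'
  have hPtop : P ≠ ∞ := lipRow_ne_top_of_straddle v hδ hYm hYp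
  -- the real inequality at every level
  have hJ : ∀ J : ℤ, P.toReal ≤ (α₀ * Ym.toReal ^ (1 / 2 : ℝ)) * (2 : ℝ) ^ ((δ / 2) * J) +
      β * (2 : ℝ) ^ (-(δ / 2) * J) * Real.sqrt Yp.toReal := by
    intro J
    have h := lipRow_le_straddle v ((5 - δ) / 2) ((5 + δ) / 2) J
    have e1 : 2 * ((5 - δ) / 2) = 5 - δ := by ring
    have e2 : 2 * ((5 + δ) / 2) = 5 + δ := by ring
    have e3 : (5 : ℝ) - (5 - δ) = δ := by ring
    have e4 : (5 : ℝ) - (5 + δ) = -δ := by ring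
    rw [e1, e2, e3, e4] at h
    have hA : ((2 : ℝ≥0∞) ^ (δ * ((J - 1 : ℤ) : ℝ)) * Gm) ^ (1 / 2 : ℝ) * Ym ^ (1 / 2 : ℝ) ≠ ∞ :=
      ENNReal.mul_ne_top (ENNReal.rpow_ne_top_of_nonneg (by norm_num)
        (ENNReal.mul_ne_top (RiccatiSlice.two_rpow_ne_top _) hGmtop)) (ENNReal.rpow_ne_top_of_nonneg (by norm_num) hYm)
    have hB : ((2 : ℝ≥0∞) ^ (-δ * (J : ℝ)) * Gp) ^ (1 / 2 : ℝ) * Yp ^ (1 / 2 : ℝ) ≠ ∞ :=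
      ENNReal.mul_ne_top (ENNReal.rpow_ne_top_of_nonneg (by norm_num)
        (ENNReal.mul_ne_top (RiccatiSlice.two_rpow_ne_top _) hGmtop)) (ENNReal.rpow_ne_top_of_nonneg (by norm_num) hYp)
    have h' := ENNReal.toReal_mono (ENNReal.add_ne_top.2 ⟨hA, hB⟩) h
    rw [ENNReal.toReal_add hA hB] at h'
    have hAr : (((2 : ℝ≥0∞) ^ (δ * ((J - 1 : ℤ) : ℝ)) * Gm) ^ (1 / 2 : ℝ) * Ym ^ (1 / 2 : ℝ)).toReal =
        (α₀ * Ym.toReal ^ (1 / 2 : ℝ)) * (2 : ℝ) ^ ((δ / 2) * J) := by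
      rw [ENNReal.toReal_mul, ← ENNReal.toReal_rpow, ← ENNReal.toReal_rpow, ENNReal.toReal_mul,
        ← ENNReal.toReal_rpow, ENNReal.toReal_ofNat, hα₀]
      have e : (2 : ℝ) ^ (δ * ((J - 1 : ℤ) : ℝ)) = (2 : ℝ) ^ (-δ) * ((2 : ℝ) ^ ((δ / 2) * J)) ^ (2 : ℝ) := by
        rw [← Real.rpow_mul (by norm_num), ← Real.rpow_add two_pos]; congr 1; push_cast; ring
      rw [e, show (2 : ℝ) ^ (-δ) * ((2 : ℝ) ^ ((δ / 2) * J)) ^ (2 : ℝ) * Gm.toReal =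
          ((2 : ℝ) ^ (-δ) * Gm.toReal) * ((2 : ℝ) ^ ((δ / 2) * J)) ^ (2 : ℝ) by ring,
        Real.mul_rpow (by positivity) (by positivity), ← Real.rpow_mul (by positivity)]
      norm_num
      ring
    have hBr : (((2 : ℝ≥0∞) ^ (-δ * (J : ℝ)) * Gp) ^ (1 / 2 : ℝ) * Yp ^ (1 / 2 : ℝ)).toReal ≤
        β * (2 : ℝ) ^ (-(δ / 2) * J) * Real.sqrt Yp.toReal := by
      rw [ENNReal.toReal_mul, ← ENNReal.toReal_rpow, ← ENNReal.toReal_rpow, ENNReal.toReal_mul,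
        ← ENNReal.toReal_rpow, ENNReal.toReal_ofNat, Real.sqrt_eq_rpow,
        Real.mul_rpow (by positivity) ENNReal.toReal_nonneg, ← Real.rpow_mul (by norm_num),
        show -δ * (J : ℝ) * (1 / 2) = -(δ / 2) * J by ring]
      have hG1 : Gp.toReal ^ (1 / 2 : ℝ) ≤ β := by rw [hβ, hGp, hGm]; linarith
      calc (2 : ℝ) ^ (-(δ / 2) * J) * Gp.toReal ^ (1 / 2 : ℝ) * Yp.toReal ^ (1 / 2 : ℝ)
          ≤ (2 : ℝ) ^ (-(δ / 2) * J) * β * Yp.toReal ^ (1 / 2 : ℝ) := by gcongr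
        _ = β * (2 : ℝ) ^ (-(δ / 2) * J) * Yp.toReal ^ (1 / 2 : ℝ) := by ring
    linarith [h', hAr.le, hAr.ge, hBr]
  -- optimise over `J`
  rcases (ENNReal.toReal_nonneg : 0 ≤ P.toReal).eq_or_lt with hP0 | hPpos
  · rw [← hP0, Real.zero_rpow (by norm_num)]
    positivity
  have hopt := dyadic_optimisation_p hPpos (by positivity) hβ0 ENNReal.toReal_nonneg (by positivity : 0 < δ / 2)
    (by positivity : 0 < δ / 2) hJ
  have e5 : 2 + 2 * (δ / 2) / (δ / 2) = (4 : ℝ) := by field_simp; ring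
  have e6 : 2 * (δ / 2) / (δ / 2) = (2 : ℝ) := by field_simp
  rw [e5] at hopt
  have hαY : (α₀ * Ym.toReal ^ (1 / 2 : ℝ)) ^ (2 * (δ / 2) / (δ / 2)) = α₀ ^ (2 * (δ / 2) / (δ / 2)) * Ym.toReal := by
    rw [Real.mul_rpow hα₀0 (by positivity), e6, ← Real.rpow_mul ENNReal.toReal_nonneg]
    norm_num
  rw [hαY] at hopt
  calc P.toReal ^ (4 : ℝ)
      ≤ (2 : ℝ) ^ (2 + 2 * (δ / 2) + 2 * (δ / 2) / (δ / 2)) * (α₀ ^ (2 * (δ / 2) / (δ / 2)) * Ym.toReal) * β ^ 2 *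
          Yp.toReal := hopt
    _ = ((2 : ℝ) ^ (2 + 2 * (δ / 2) + 2 * (δ / 2) / (δ / 2)) * α₀ ^ (2 * (δ / 2) / (δ / 2)) * β ^ 2) *
          Ym.toReal * Yp.toReal := by ring
    _ ≤ Cbig * Ym.toReal * Yp.toReal := by
        gcongr
        rw [hCbig]; linarith

end Summit.NavierStokesRegularity.FluidComputer.StraddleInterpolation

end
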